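import Literature.Analysis.FunctionSpaces.TorusPlanarLift
import Literature.Analysis.FunctionSpaces.TorusFluidGlue
import Literature.Analysis.FunctionSpaces.TorusFourierCalculus
import Literature.Analysis.FunctionSpaces.TorusMollifierEstimates
import Literature.Analysis.FluidPDE.PassiveScalar
import Literature.Analysis.FluidPDE.LerayHopf
import HarnessLib

/-!
# `2½`-dimensional classical Navier–Stokes solutions on `T³` from planar data

Analysis/FluidPDE support file for the mixing-based anomalous-dissipation constructions
(Bruè–De Lellis, Comm. Math. Phys. 400 (2023), §3 and (5.4); Cheskidov, arXiv:2311.04182 (2023),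
§3 (3.7)–(3.13) and §6; Majda–Bertozzi 2002, §2.3.1): a planar velocity field
`V : ℝ → T² → ℝ²`, divergence free at every time, a planar scalar `R : ℝ → T² → ℝ` and an
arbitrary planar pressure potential `φ : ℝ → T² → ℝ`, all jointly smooth on a time set `S`, give
the velocity field `u(t) = (V(t), R(t)) ∘ π` on `T³` (`Torus.twoHalf`, accepted
`TorusPlanarLift`), which is a classical solution of the forced Navier–Stokes system
(`Torus.IsClassicalNSSolutionOn S ν f u p`) with pressure `p(t) = φ(t) ∘ π` and the force
`f = Torus.twoHalfForce S ν V R φ` whose planar part is `∂ₜV + (V·∇)V - νΔV + ∇φ` and whose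
vertical part is the advection–diffusion residual `∂ₜR + V·∇R - νΔR` (Cheskidov 2023, (3.13),
(6.8); Bruè–De Lellis 2023, (5.4)). Nothing is assumed about the dynamics of `V`, `R`: the force
is *defined* as the residual, which is how both sources read the Navier–Stokes equations with a
prescribed velocity (Cheskidov 2023, §3 after (3.12): `u^m(t)` "satisfies (NSE) with force `g^m`";
Bruè–De Lellis 2023, (5.4)).

Besides the packaging theorem `Torus.isClassicalNSSolutionOn_twoHalf` the file proves the
bookkeeping identities consumed by energy/dissipation computations for such fields:

* `Torus.gradient_comp_planarProj` — `∇(φ ∘ π) = (∇φ, 0) ∘ π`;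
* `Torus.integral_norm_sq_twoHalf` — `∫_{T³} ‖(V,R)∘π‖² = ∫_{T²} ‖V‖² + ∫_{T²} R²`;
* `Torus.gradNormSq_twoHalf`, `Torus.toReal_eGradNormSq_twoHalf` —
  `‖∇u‖²_{L²(T³)} = ‖∇V‖²_{L²(T²)} + ‖∇R‖²_{L²(T²)}` (derivative-based and spectral forms);
* `Torus.eLpNorm_twoHalf_le` — `‖(V,R)∘π‖_{L²(T³)} ≤ ‖V‖_{L²(T²)} + ‖R‖_{L²(T²)}`, whence
  `Torus.memLp_twoHalf`, `Torus.continuousInLpOn_twoHalf`;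
* `Torus.hasZeroMean_twoHalf` — zero planar means give zero mean on `T³`;
* `Torus.periodic_twoHalf` — time-periodicity is inherited.

## References

* A. Cheskidov, *Dissipation anomaly and anomalous dissipation in incompressible fluid flows*,
  arXiv:2311.04182 (2023), §3, (3.7), (3.12)–(3.13); §6, (6.8) and p. 18 (`u^{ν_m} = (v^m, a_m θ^m)`).
* E. Bruè, C. De Lellis, *Anomalous dissipation for the forced 3D Navier–Stokes equations*,
  Comm. Math. Phys. 400 (2023), §3 and (5.4).
* A. J. Majda, A. L. Bertozzi, *Vorticity and Incompressible Flow* (CUP 2002), §2.3.1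
  (two-and-a-half-dimensional flows).
-/

open MeasureTheory Set Filter Topology Function
open scoped ENNReal NNReal InnerProductSpace
open Literature.Analysis.FunctionSpaces.Torus (twoHalf planarProj planarProjE planarEmbed twoHalf_apply_two
  twoHalf_apply_castSucc last_two_eq)

noncomputable section

namespace Literature.Analysis.FluidPDE

namespace Torus

/-- The flat three-torus (local notation). [folklore] -/
local notation "𝕋³" => UnitAddTorus (Fin 3)
/-- The flat two-torus (local notation). [folklore] -/
local notation "𝕋²" => UnitAddTorus (Fin 2)
/-- `ℝ³` (local notation). [folklore] -/
local notation "E³" => EuclideanSpace ℝ (Fin 3)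
/-- `ℝ²` (local notation). [folklore] -/
local notation "E²" => EuclideanSpace ℝ (Fin 2)

/-! ## The force of the `2½`-dimensional ansatz -/

/-- **The Navier–Stokes force of the `2½`-dimensional ansatz** (Cheskidov 2023, (3.13) and
(6.8); Bruè–De Lellis 2023, (5.4)): for planar data `V` (velocity), `R` (scalar) and a planar
pressure potential `φ`, the field on `T³` whose planar part is
`∂ₜV + (V·∇)V - ν ΔV + ∇φ` and whose vertical part is the advection–diffusion residual
`∂ₜR + V·∇R - ν ΔR`, lifted along `π : T³ → T²` (one-sided time derivatives within the time set
`S`). With this force, `u = (V, R) ∘ π` and `p = φ ∘ π` solve the Navier–Stokes system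
(`isClassicalNSSolutionOn_twoHalf`). [cite: Cheskidov2023, (3.13) and (6.8)] -/
def twoHalfForce (S : Set ℝ) (ν : ℝ) (V : ℝ → 𝕋² → E²) (R φ : ℝ → 𝕋² → ℝ) (t : ℝ) : 𝕋³ → E³ :=
  twoHalf
    (fun y => FunctionSpaces.Torus.timeDerivWithin S V t y + FunctionSpaces.Torus.convect (V t) (V t) y - ν • FunctionSpaces.Torus.laplacian (V t) y +
      FunctionSpaces.Torus.gradient (φ t) y)
    (fun y => FunctionSpaces.Torus.timeDerivWithin S R t y + ⟪V t y, FunctionSpaces.Torus.gradient (R t) y⟫_ℝ -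
      ν * FunctionSpaces.Torus.laplacian (R t) y)

/-- Unfolding `twoHalfForce` at a point. [cite: Cheskidov2023, (3.13) and (6.8)] -/
theorem twoHalfForce_apply (S : Set ℝ) (ν : ℝ) (V : ℝ → 𝕋² → E²) (R φ : ℝ → 𝕋² → ℝ) (t : ℝ)
    (x : 𝕋³) :
    twoHalfForce S ν V R φ t x =
      twoHalf
        (fun y => FunctionSpaces.Torus.timeDerivWithin S V t y + FunctionSpaces.Torus.convect (V t) (V t) y - ν • FunctionSpaces.Torus.laplacian (V t) y +
          FunctionSpaces.Torus.gradient (φ t) y)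
        (fun y => FunctionSpaces.Torus.timeDerivWithin S R t y + ⟪V t y, FunctionSpaces.Torus.gradient (R t) y⟫_ℝ -
          ν * FunctionSpaces.Torus.laplacian (R t) y) x :=
  rfl

/-! ## Gradients of planar lifts -/

/-- **Gradient of a planar lift**: `∇(φ ∘ π)(x) = (∇φ(πx), 0)`, i.e. `∇(φ ∘ π) = twoHalf (∇φ) 0`,
for `C¹` planar `φ` (chain rule through the linear projection `πE`, `Torus.fderiv_comp_planarProj`,
and the Riesz representation `⟪∇θ(x), w⟫ = Dθ(x) w`). [folklore] -/
theorem gradient_comp_planarProj {φ : 𝕋² → ℝ} (hφ : FunctionSpaces.Torus.IsContDiff 1 φ) :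
    FunctionSpaces.Torus.gradient (φ ∘ planarProj) = twoHalf (FunctionSpaces.Torus.gradient φ) 0 := by
  funext x
  refine ext_inner_right ℝ fun w => ?_
  rw [FunctionSpaces.Torus.inner_gradient_left, FunctionSpaces.Torus.fderiv_comp_planarProj hφ, ContinuousLinearMap.comp_apply,
    ← FunctionSpaces.Torus.inner_gradient_left, FunctionSpaces.Torus.inner_twoHalf_left]
  simp

/-! ## The packaging theorem -/

/-- **`2½`-dimensional classical Navier–Stokes solutions** (Cheskidov 2023, §3 after (3.12):
"`u^m(t)` satisfies (NSE) with force `g^m`", (3.13), and §6 p. 18; Bruè–De Lellis 2023, §3,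
(5.4); Majda–Bertozzi 2002, §2.3.1). Let `S` be a time set of unique differentiability, `V`, `R`,
`φ` jointly smooth on `S × T²` with `div V(t) = 0` for `t ∈ S`. Then `u(t) = (V(t), R(t)) ∘ π`,
`p(t) = φ(t) ∘ π` is a classical solution on `S × T³` of the Navier–Stokes system with viscosity
`ν` and force `twoHalfForce S ν V R φ`: `u`, `p` are jointly smooth, `div u = (div V) ∘ π = 0`,
and `∂ₜu + (u·∇)u = νΔu - ∇p + f` holds because `∂ₜ`, `(u·∇)u`, `Δ` act slice-wise on the planar
data (`timeDerivWithin_twoHalf`, `convect_twoHalf`, `laplacian_twoHalf` of `TorusPlanarLift`) and `∇p = (∇φ, 0) ∘ π`. [cite: Cheskidov2023, §3 (3.12)–(3.13) and §6 p. 18] -/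
theorem isClassicalNSSolutionOn_twoHalf {S : Set ℝ} (hS : UniqueDiffOn ℝ S) (ν : ℝ)
    {V : ℝ → 𝕋² → E²} {R φ : ℝ → 𝕋² → ℝ}
    (hV : FunctionSpaces.Torus.IsSmoothSpaceTimeOn S V) (hR : FunctionSpaces.Torus.IsSmoothSpaceTimeOn S R) (hφ : FunctionSpaces.Torus.IsSmoothSpaceTimeOn S φ)
    (hdiv : ∀ t ∈ S, FunctionSpaces.Torus.IsDivFree (V t)) :
    FunctionSpaces.Torus.IsClassicalNSSolutionOn S ν (twoHalfForce S ν V R φ) (fun t => twoHalf (V t) (R t))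
      (fun t => φ t ∘ planarProj) where
  smooth_velocity := hV.twoHalf hR
  smooth_pressure := hφ.comp_planarProj
  divFree t ht := (hdiv t ht).twoHalf (R t)
  momentum t ht x := by
    have hVs : FunctionSpaces.Torus.IsSmooth (V t) := hV.isSmooth_slice ht
    have hRs : FunctionSpaces.Torus.IsSmooth (R t) := hR.isSmooth_slice ht
    have hφs : FunctionSpaces.Torus.IsSmooth (φ t) := hφ.isSmooth_slice ht
    have hV1 : FunctionSpaces.Torus.IsContDiff 1 (V t) := hVs.isContDiff (by simp)
    have hR1 : FunctionSpaces.Torus.IsContDiff 1 (R t) := hRs.isContDiff (by simp)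
    have hφ1 : FunctionSpaces.Torus.IsContDiff 1 (φ t) := hφs.isContDiff (by simp)
    change FunctionSpaces.Torus.timeDerivWithin S (fun s => twoHalf (V s) (R s)) t x +
        FunctionSpaces.Torus.convect (twoHalf (V t) (R t)) (twoHalf (V t) (R t)) x =
      ν • FunctionSpaces.Torus.laplacian (twoHalf (V t) (R t)) x - FunctionSpaces.Torus.gradient (φ t ∘ planarProj) x +
        twoHalfForce S ν V R φ t x
    rw [FunctionSpaces.Torus.timeDerivWithin_twoHalf hV hR hS ht, FunctionSpaces.Torus.convect_twoHalf hV1 hR1, FunctionSpaces.Torus.laplacian_twoHalf hVs hRs,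
      gradient_comp_planarProj hφ1, twoHalfForce_apply]
    ext i
    refine Fin.lastCases ?_ (fun j => ?_) i
    · rw [last_two_eq]
      simp only [PiLp.add_apply, PiLp.sub_apply, PiLp.smul_apply, twoHalf_apply_two,
        Pi.zero_apply, smul_eq_mul]
      ring
    · simp only [PiLp.add_apply, PiLp.sub_apply, PiLp.smul_apply, twoHalf_apply_castSucc,
        smul_eq_mul]
      ring


/-! ## Energy, dissipation and `L²` bookkeeping for `2½`-dimensional fields -/

section Bookkeeping

variable {V : 𝕋² → E²} {R : 𝕋² → ℝ}

/-- **Energy of a `2½`-dimensional field**: `∫_{T³} ‖(V,R)∘π‖² = ∫_{T²} ‖V‖² + ∫_{T²} R²` for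
continuous planar data (pointwise `‖(V,R)(x)‖² = ‖V(πx)‖² + R(πx)²` and `π` preserves volume;
the identity behind the energy normalisation of `u^{ν_m} = (v^m, a_m θ^m)` in Cheskidov 2023, §6). [folklore] -/
theorem integral_norm_sq_twoHalf (hV : Continuous V) (hR : Continuous R) :
    ∫ x, ‖twoHalf V R x‖ ^ 2 = (∫ y, ‖V y‖ ^ 2) + ∫ y, R y ^ 2 := by
  simp_rw [FunctionSpaces.Torus.norm_sq_twoHalf]
  rw [FunctionSpaces.Torus.integral_comp_planarProj (b := fun y => ‖V y‖ ^ 2 + R y ^ 2)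
    ((hV.norm.pow 2).add (hR.pow 2)).aestronglyMeasurable]
  exact integral_add ((hV.norm.pow 2).integrable_unitAddTorus) ((hR.pow 2).integrable_unitAddTorus)

/-- Pointwise splitting of the squared gradient of a `2½`-dimensional field with `C¹` data:
`∑ᵢ ‖∂ᵢ(V,R)∘π (x)‖² = ∑ⱼ ‖∂ⱼV(πx)‖² + ∑ⱼ (∂ⱼR(πx))²` (`j` over the two planar directions; the
vertical derivative vanishes). [folklore] -/
theorem sum_norm_sq_partialDeriv_twoHalf (hV : FunctionSpaces.Torus.IsContDiff 1 V)
    (hR : FunctionSpaces.Torus.IsContDiff 1 R) (x : 𝕋³) :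
    ∑ i, ‖FunctionSpaces.Torus.partialDeriv i (twoHalf V R) x‖ ^ 2 =
      ∑ j, ‖FunctionSpaces.Torus.partialDeriv j V (planarProj x)‖ ^ 2 +
        ∑ j, FunctionSpaces.Torus.partialDeriv j R (planarProj x) ^ 2 := by
  rw [Fin.sum_univ_castSucc, FunctionSpaces.Torus.partialDeriv_twoHalf_last, Pi.zero_apply, norm_zero,
    zero_pow two_ne_zero, add_zero, ← Finset.sum_add_distrib]
  refine Finset.sum_congr rfl fun j _ => ?_
  rw [FunctionSpaces.Torus.partialDeriv_twoHalf_castSucc hV hR, FunctionSpaces.Torus.norm_sq_twoHalf]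

/-- `‖∇R(y)‖² = ∑ⱼ (∂ⱼR(y))²` for `C¹` scalars on `T²` (coordinates of the gradient,
`Torus.gradient_apply`). [folklore] -/
theorem norm_sq_gradient_eq_sum (hR : FunctionSpaces.Torus.IsContDiff 1 R) (y : 𝕋²) :
    ‖FunctionSpaces.Torus.gradient R y‖ ^ 2 = ∑ j, FunctionSpaces.Torus.partialDeriv j R y ^ 2 := by
  rw [EuclideanSpace.norm_sq_eq]
  refine Finset.sum_congr rfl fun j _ => ?_
  rw [FunctionSpaces.Torus.gradient_apply hR, Real.norm_eq_abs, sq_abs]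

/-- **Dissipation of a `2½`-dimensional field** (derivative form):
`‖∇((V,R)∘π)‖²_{L²(T³)} = ‖∇V‖²_{L²(T²)} + ‖∇R‖²_{L²(T²)}`, i.e.
`gradNormSq (twoHalf V R) = gradNormSq V + scalarGradNormSq R`, for smooth planar data
(Cheskidov 2023, §6, first display on p. 19: `‖∇u^{ν_m}‖² = ‖∇v^m‖² + a_m² ‖∇θ^m‖²`;
Lemma 3.2). [cite: Cheskidov2023, §6 p. 19] -/
theorem gradNormSq_twoHalf (hV : FunctionSpaces.Torus.IsSmooth V) (hR : FunctionSpaces.Torus.IsSmooth R) :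
    FunctionSpaces.Torus.gradNormSq (twoHalf V R) =
      FunctionSpaces.Torus.gradNormSq V + scalarGradNormSq R := by
  have hV1 : FunctionSpaces.Torus.IsContDiff 1 V := hV.isContDiff (by simp)
  have hR1 : FunctionSpaces.Torus.IsContDiff 1 R := hR.isContDiff (by simp)
  have hcV : Continuous fun y => ∑ j, ‖FunctionSpaces.Torus.partialDeriv j V y‖ ^ 2 :=
    continuous_finsetSum _ fun j _ => ((hV.partialDeriv j).continuous.norm.pow 2)
  have hcR : Continuous fun y => ∑ j, FunctionSpaces.Torus.partialDeriv j R y ^ 2 :=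
    continuous_finsetSum _ fun j _ => ((hR.partialDeriv j).continuous.pow 2)
  unfold FunctionSpaces.Torus.gradNormSq scalarGradNormSq
  simp_rw [sum_norm_sq_partialDeriv_twoHalf hV1 hR1, norm_sq_gradient_eq_sum hR1]
  rw [FunctionSpaces.Torus.integral_comp_planarProj
    (b := fun y => ∑ j, ‖FunctionSpaces.Torus.partialDeriv j V y‖ ^ 2 +
      ∑ j, FunctionSpaces.Torus.partialDeriv j R y ^ 2) (hcV.add hcR).aestronglyMeasurable]
  exact integral_add hcV.integrable_unitAddTorus hcR.integrable_unitAddTorus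

/-- **Dissipation of a `2½`-dimensional field** (spectral form, the one entering
`Turb.meanDissipation`): `(eGradNormSq ((V,R)∘π)).toReal = gradNormSq V + scalarGradNormSq R` for
smooth planar data (`Torus.eGradNormSq_eq_ofReal_gradNormSq` on the smooth field `(V,R)∘π`, then
`gradNormSq_twoHalf`). [cite: Cheskidov2023, §6 p. 19] -/
theorem toReal_eGradNormSq_twoHalf (hV : FunctionSpaces.Torus.IsSmooth V)
    (hR : FunctionSpaces.Torus.IsSmooth R) :
    (FunctionSpaces.Torus.eGradNormSq (twoHalf V R)).toReal =
      FunctionSpaces.Torus.gradNormSq V + scalarGradNormSq R := by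
  rw [FunctionSpaces.Torus.eGradNormSq_eq_ofReal_gradNormSq (hV.twoHalf hR),
    ENNReal.toReal_ofReal (FunctionSpaces.Torus.gradNormSq_nonneg _), gradNormSq_twoHalf hV hR]

/-- The scalar dissipation is a lower bound for the dissipation of the `2½`-dimensional field:
`‖∇R‖²_{L²(T²)} ≤ (eGradNormSq ((V,R)∘π)).toReal` (drop the planar part `‖∇V‖² ≥ 0`;
Cheskidov 2023, §6 p. 19 / Lemma 3.2). [cite: Cheskidov2023, §6 p. 19] -/
theorem scalarGradNormSq_le_toReal_eGradNormSq_twoHalf (hV : FunctionSpaces.Torus.IsSmooth V)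
    (hR : FunctionSpaces.Torus.IsSmooth R) :
    scalarGradNormSq R ≤ (FunctionSpaces.Torus.eGradNormSq (twoHalf V R)).toReal := by
  rw [toReal_eGradNormSq_twoHalf hV hR]
  linarith [FunctionSpaces.Torus.gradNormSq_nonneg V]

/-- The purely planar and purely vertical `2½`-dimensional fields add up: `(V,R) = (V,0) + (0,R)`. [folklore] -/
theorem twoHalf_eq_add (V : 𝕋² → E²) (R : 𝕋² → ℝ) :
    twoHalf V R = twoHalf V 0 + twoHalf 0 R := by
  rw [← FunctionSpaces.Torus.twoHalf_add, add_zero, zero_add]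

/-- `‖(V, 0)(x)‖ = ‖V(πx)‖`. [folklore] -/
theorem norm_twoHalf_zero_right (V : 𝕋² → E²) (x : 𝕋³) : ‖twoHalf V 0 x‖ = ‖V (planarProj x)‖ := by
  have h := FunctionSpaces.Torus.norm_sq_twoHalf V 0 x
  simp only [Pi.zero_apply, ne_eq, OfNat.ofNat_ne_zero, not_false_eq_true, zero_pow, add_zero] at h
  exact (pow_left_inj₀ (norm_nonneg _) (norm_nonneg _) two_ne_zero).1 h

/-- `‖(0, R)(x)‖ = |R(πx)|`. [folklore] -/
theorem norm_twoHalf_zero_left (R : 𝕋² → ℝ) (x : 𝕋³) : ‖twoHalf 0 R x‖ = ‖R (planarProj x)‖ := by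
  have h := FunctionSpaces.Torus.norm_sq_twoHalf 0 R x
  simp only [Pi.zero_apply, norm_zero, ne_eq, OfNat.ofNat_ne_zero, not_false_eq_true, zero_pow,
    zero_add] at h
  rw [Real.norm_eq_abs]
  rw [← sq_abs (R _)] at h
  exact (pow_left_inj₀ (norm_nonneg _) (abs_nonneg _) two_ne_zero).1 h

/-- `L²` norms of purely planar `2½`-dimensional fields: `‖(V,0)∘π‖_{L^p(T³)} = ‖V‖_{L^p(T²)}`
(`π` is measure preserving). [folklore] -/
theorem eLpNorm_twoHalf_zero_right (hV : AEStronglyMeasurable V volume) (p : ℝ≥0∞) :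
    eLpNorm (twoHalf V 0) p (volume : Measure 𝕋³) = eLpNorm V p volume := by
  rw [← eLpNorm_norm, show (fun x => ‖twoHalf V 0 x‖) = (fun y => ‖V y‖) ∘ planarProj from
    funext fun x => norm_twoHalf_zero_right V x,
    eLpNorm_comp_measurePreserving hV.norm FunctionSpaces.Torus.measurePreserving_planarProj, eLpNorm_norm]

/-- `L²` norms of purely vertical `2½`-dimensional fields: `‖(0,R)∘π‖_{L^p(T³)} = ‖R‖_{L^p(T²)}`. [folklore] -/
theorem eLpNorm_twoHalf_zero_left (hR : AEStronglyMeasurable R volume) (p : ℝ≥0∞) :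
    eLpNorm (twoHalf 0 R) p (volume : Measure 𝕋³) = eLpNorm R p volume := by
  rw [← eLpNorm_norm, show (fun x => ‖twoHalf 0 R x‖) = (fun y => ‖R y‖) ∘ planarProj from
    funext fun x => norm_twoHalf_zero_left R x,
    eLpNorm_comp_measurePreserving hR.norm FunctionSpaces.Torus.measurePreserving_planarProj, eLpNorm_norm]

/-- `2½`-dimensional fields with (a.e. strongly) measurable data are (a.e. strongly) measurable. [folklore] -/
theorem aestronglyMeasurable_twoHalf (hV : AEStronglyMeasurable V volume)
    (hR : AEStronglyMeasurable R volume) :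
    AEStronglyMeasurable (twoHalf V R) (volume : Measure 𝕋³) := by
  rw [FunctionSpaces.Torus.twoHalf_eq_comp]
  refine AEStronglyMeasurable.comp_measurePreserving ?_ FunctionSpaces.Torus.measurePreserving_planarProj
  exact planarEmbed.continuous.comp_aestronglyMeasurable (hV.prodMk hR)

/-- **`L^p` splitting of `2½`-dimensional fields**:
`‖(V,R)∘π‖_{L^p(T³)} ≤ ‖V‖_{L^p(T²)} + ‖R‖_{L^p(T²)}` for `1 ≤ p` (triangle inequality for
`(V,R) = (V,0) + (0,R)` and measure preservation of `π`); used with `p = 2` for the convergence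
of `2½`-dimensional forces in `C(ℝ; L²)` (Cheskidov 2023, §6, `h^m → h`, `g^m → g`). [folklore] -/
theorem eLpNorm_twoHalf_le (hV : AEStronglyMeasurable V volume) (hR : AEStronglyMeasurable R volume)
    {p : ℝ≥0∞} (hp : 1 ≤ p) :
    eLpNorm (twoHalf V R) p (volume : Measure 𝕋³) ≤ eLpNorm V p volume + eLpNorm R p volume := by
  rw [twoHalf_eq_add, ← eLpNorm_twoHalf_zero_right hV p, ← eLpNorm_twoHalf_zero_left hR p]
  exact eLpNorm_add_le (aestronglyMeasurable_twoHalf hV aestronglyMeasurable_zero)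
    (aestronglyMeasurable_twoHalf aestronglyMeasurable_zero hR) hp

/-- `L^p` distance of two `2½`-dimensional fields is controlled by the planar distances. [folklore] -/
theorem eLpNorm_twoHalf_sub_twoHalf_le {V' : 𝕋² → E²} {R' : 𝕋² → ℝ}
    (hV : AEStronglyMeasurable V volume) (hV' : AEStronglyMeasurable V' volume)
    (hR : AEStronglyMeasurable R volume) (hR' : AEStronglyMeasurable R' volume)
    {p : ℝ≥0∞} (hp : 1 ≤ p) :
    eLpNorm (twoHalf V R - twoHalf V' R') p (volume : Measure 𝕋³) ≤
      eLpNorm (V - V') p volume + eLpNorm (R - R') p volume := by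
  rw [← FunctionSpaces.Torus.twoHalf_sub]
  exact eLpNorm_twoHalf_le (hV.sub hV') (hR.sub hR') hp

/-- `2½`-dimensional fields with `L^p` data are in `L^p`. [folklore] -/
theorem memLp_twoHalf {p : ℝ≥0∞} (hp : 1 ≤ p) (hV : MemLp V p volume) (hR : MemLp R p volume) :
    MemLp (twoHalf V R) p (volume : Measure 𝕋³) := by
  refine ⟨aestronglyMeasurable_twoHalf hV.1 hR.1, ?_⟩
  calc eLpNorm (twoHalf V R) p volume ≤ eLpNorm V p volume + eLpNorm R p volume :=
        eLpNorm_twoHalf_le hV.1 hR.1 hp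
    _ < ⊤ := ENNReal.add_lt_top.2 ⟨hV.2, hR.2⟩

/-- **Zero mean is inherited**: if `∫_{T²} V = 0` and `∫_{T²} R = 0` (integrable data) then
`∫_{T³} (V,R)∘π = 0` (the planar lift commutes with integration since `π` preserves volume;
used for the mean-zero clause of `2½`-dimensional velocities and forces). [folklore] -/
theorem hasZeroMean_twoHalf (hVi : Integrable V volume) (hRi : Integrable R volume)
    (hV : FunctionSpaces.Torus.HasZeroMean V) (hR : FunctionSpaces.Torus.HasZeroMean R) :
    FunctionSpaces.Torus.HasZeroMean (twoHalf V R) := by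
  unfold FunctionSpaces.Torus.HasZeroMean at hV hR ⊢
  rw [FunctionSpaces.Torus.twoHalf_eq_comp,
    show (∫ x : 𝕋³, ((fun y => planarEmbed (V y, R y)) ∘ planarProj) x) =
      ∫ x : 𝕋³, (fun y => planarEmbed (V y, R y)) (planarProj x) from rfl,
    FunctionSpaces.Torus.integral_comp_planarProj
      (planarEmbed.continuous.comp_aestronglyMeasurable (hVi.1.prodMk hRi.1)),
    planarEmbed.integral_comp_comm (hVi.prodMk hRi), integral_pair hVi hRi, hV, hR,
    Prod.mk_zero_zero, map_zero]

end Bookkeeping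

/-! ## Time-dependent `2½`-dimensional fields: periodicity and `C(S; L²)` -/

section TimeDependent

variable {V : ℝ → 𝕋² → E²} {R : ℝ → 𝕋² → ℝ}

/-- Time-periodicity of the planar data is inherited by the `2½`-dimensional field (as for
`u^{ν_m} = (v^m, a_m θ^m)` in Cheskidov 2023, §6). [folklore] -/
theorem periodic_twoHalf {τ : ℝ} (hV : Periodic V τ) (hR : Periodic R τ) :
    Periodic (fun t => twoHalf (V t) (R t)) τ := fun t => by
  simp only [hV t, hR t]

/-- Time-periodicity of the `2½`-dimensional force from periodic planar data and potential
(the time derivative within `univ` of a periodic function is periodic, `deriv_comp_add_const`). [folklore] -/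
theorem periodic_twoHalfForce {τ ν : ℝ} {φ : ℝ → 𝕋² → ℝ} (hV : Periodic V τ) (hR : Periodic R τ)
    (hφ : Periodic φ τ) : Periodic (twoHalfForce univ ν V R φ) τ := fun t => by
  have hdV : FunctionSpaces.Torus.timeDerivWithin univ V (t + τ) =
      FunctionSpaces.Torus.timeDerivWithin univ V t := by
    funext y
    simp only [FunctionSpaces.Torus.timeDerivWithin, derivWithin_univ]
    rw [← deriv_comp_add_const (fun s => V s y) τ t]
    simp only [hV _]
  have hdR : FunctionSpaces.Torus.timeDerivWithin univ R (t + τ) =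
      FunctionSpaces.Torus.timeDerivWithin univ R t := by
    funext y
    simp only [FunctionSpaces.Torus.timeDerivWithin, derivWithin_univ]
    rw [← deriv_comp_add_const (fun s => R s y) τ t]
    simp only [hR _]
  funext x
  simp only [twoHalfForce_apply, hdV, hdR, hV t, hR t, hφ t]

/-- **`C(S; L²)` for `2½`-dimensional fields**: if the planar data are continuous in time with
values in `L²(T²)` on `S`, so is `(V,R)∘π` with values in `L²(T³)` (`eLpNorm_twoHalf_sub_twoHalf_le`). [folklore] -/
theorem continuousInLpOn_twoHalf {S : Set ℝ} (hV : ContinuousInLpOn S 2 V) (hR : ContinuousInLpOn S 2 R) :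
    ContinuousInLpOn S 2 (fun t => twoHalf (V t) (R t)) := by
  refine ⟨fun t ht => memLp_twoHalf one_le_two (hV.1 t ht) (hR.1 t ht), fun t₀ ht₀ => ?_⟩
  have h := (hV.2 t₀ ht₀).add (hR.2 t₀ ht₀)
  rw [add_zero] at h
  refine tendsto_of_tendsto_of_tendsto_of_le_of_le' tendsto_const_nhds h
    (Eventually.of_forall fun t => zero_le) ?_
  filter_upwards [self_mem_nhdsWithin] with t ht
  exact eLpNorm_twoHalf_sub_twoHalf_le (hV.1 t ht).1 (hV.1 t₀ ht₀).1 (hR.1 t ht).1 (hR.1 t₀ ht₀).1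
    one_le_two

end TimeDependent

end Torus

end Literature.Analysis.FluidPDE

end
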